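import Summits.CriticalPhenomena.PercolationContinuityZ3.Theorems.PercNearOneGluingNoHeavyLowerTailSunflowerChainCertificateFinal
import Summits.CriticalPhenomena.PercolationContinuityZ3.Theorems.PercNearOneGluingNoHeavyLowerTailSunflowerChainCertificateCheckGenericA
import Summits.CriticalPhenomena.PercolationContinuityZ3.Theorems.PercNearOneGluingNoHeavyLowerTailSunflowerChainCertificateCheckGenericB
import Summits.CriticalPhenomena.PercolationContinuityZ3.Theorems.PercNearOneGluingNoHeavyLowerTailSunflowerChainCertificateCheckRest
import HarnessLib
import HarnessLib.Audit

/-!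
# `NoHeavyLowerTail` (crux stmt-CriticalPhenomena-4575), chain certificates — ASSEMBLY: `ThreeBlockMedianCertificate` HOLDS, and the payer
# dichotomy (C1-law) `max(a,b)·(ab − e₂(c)) ≥ e₃(c)` for every three-block chain composition, unconditionally

Support file (seat `prim-ineq-prove-1` gen 33; `--supports stmt-CriticalPhenomena-4575`).  No `sorry`; axioms standard + `Lean.ofReduceBool` inherited from the three
compiled-check files.  This closes the typed obligation `ChainCert.ThreeBlockMedianCertificate` of …SunflowerChainCertificate (p243463): the g31 theorem
(FINDING-GSATLAS-prove1-g31.md §4c — previously a computer-assisted proof outside Lean, replicated three times) is now a Lean theorem, and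
`e3_le_max_mul_AG_three_blocks` becomes unconditional (`e3_le_max_mul_AG_three_blocks'`): for EVERY product of three finite chains, every monotone labelling
into `M_K` and all nonnegative block weights — hence every sunflower map on a Boolean cube reading three disjoint blocks through monotone totally ordered
summaries, under every product measure — the larger of kernel and bottom pays: `e₃(c) ≤ max(a,b)·(ab − e₂(c))`.  Memo FINDING-CHAINCERT-prove1-g33.md.
-/

namespace Summit.CriticalPhenomena.PercolationContinuityZ3.Theorems.SunflowerPartition

namespace ChainCert

/-- The admissible 2-cell prefixes of the generic pattern (compiled evaluation of a six-element list). [this work] -/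
theorem enumSeq_gen_two : enumSeq (choicesCell (cmpTabs (leTab bgen))) 2 = [[0, 0], [0, 1], [0, 2], [1, 1], [1, 2], [2, 2]] := by
  native_decide

/-- All chunks of the generic pattern. [this work] -/
theorem check_gen_chunks : ∀ pre ∈ enumSeq (choicesCell (cmpTabs (leTab bgen))) 2, checkPatternFrom bgen pre = true := by
  intro pre hpre
  rw [enumSeq_gen_two] at hpre
  simp only [List.mem_cons, List.mem_nil_iff, or_false] at hpre
  rcases hpre with rfl | rfl | rfl | rfl | rfl | rfl
  · exact check_gen00
  · exact check_gen01
  · exact check_gen02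
  · exact check_gen11
  · exact check_gen12
  · exact check_gen22

/-- **THE THREE-BLOCK MEDIAN CERTIFICATE HOLDS** (kernel replay of the g31 theorem: reduction …ChainCertificate/Structure/Duality/Local, verified
enumeration …Enumeration/Checker/Reps/Sound/Final, compiled evaluation …CheckGenericA/B, …CheckRest). [this work] -/
theorem threeBlockMedianCertificate_holds : ThreeBlockMedianCertificate := by
  refine threeBlockMedianCertificate_of_chunked (fun b => if b = bgen then 2 else 0) (fun b => by split <;> omega) ?_
  intro b pre hpre
  by_cases hb : b = bgen
  · subst hb
    rw [if_pos rfl] at hpre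
    exact check_gen_chunks pre hpre
  · rw [if_neg hb] at hpre
    simp only [enumSeq, List.mem_singleton] at hpre
    subst hpre
    have h := check_rest
    rw [List.all_eq_true] at h
    have hmem : b ∈ allPatterns.filter fun b => b ≠ bgen := by
      rw [List.mem_filter]; exact ⟨mem_allPatterns b, by simpa using hb⟩
    exact h b hmem

/-- **THE PAYER DICHOTOMY (C1-law) FOR THREE BLOCKS, UNCONDITIONALLY**: for every product of three finite chains, every monotone labelling
(`ChainCert.IsMono`: bottom a down-set, kernel an up-set, comparable petal points in the same petal) and all nonnegative block weights,
`e₃(c) ≤ max(a,b)·(ab − e₂(c))`. [this work] -/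
theorem e3_le_max_mul_AG_three_blocks' (n : Fin 3 → ℕ) (lab : Pt n → ℕ) (hlab : IsMono lab)
    (w : (e : Fin 3) → Fin (n e) → ℝ) (hw : ∀ e i, 0 ≤ w e i) :
    e3 lab w ≤ max (mass lab w 1) (mass lab w 0) * (mass lab w 1 * mass lab w 0 - e2 lab w) :=
  e3_le_max_mul_AG_three_blocks threeBlockMedianCertificate_holds n lab hlab w hw

end ChainCert

end Summit.CriticalPhenomena.PercolationContinuityZ3.Theorems.SunflowerPartition
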